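import Literature.Analysis.FluidPDE.TaoCascadeZeroScaleCoarseBound
import Literature.Analysis.FluidPDE.TaoCascadeZeroScaleCoarseLevels
import Literature.Analysis.FluidPDE.TaoCascadeZeroScaleFence
import Literature.Analysis.FluidPDE.TaoCascadeZeroScaleNextState
import Literature.Analysis.FluidPDE.TaoCascadeDrainEnergy
import HarnessLib

/-!
# Tao's cascade ODE, §6.7: the drain at `τ₁` in the `ZeroScale.Setting` ((6.174), (6.184)–(6.186))

T. Tao, *Finite time blowup for an averaged three-dimensional Navier–Stokes equation*,
J. Amer. Math. Soc. **29** (2016), 601–674 = arXiv:1402.0290v3, §6.7, last paragraph: "By (6.185),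
(6.188) and Gronwall's inequality, we conclude that `E*(t) ≲ exp(-0.05(1+ε₀)^{5/2}K(t - t_c - 1/K))
+ K⁻²⁸` for all `t ∈ [t_c + 1/K, τ₁]`; by (6.184), we thus have
`½a₀²(τ₁) + ½d₀²(τ₁) ≲ exp(-0.05(1+ε₀)^{5/2}K^{1/2}) + K⁻²⁸`. In particular, we have (6.174)."

In the packaging `ZeroScale.Setting` (`TaoCascadeZeroScaleCritical/TauOne.lean`) and for `K ≥ 10¹⁸`
(the largeness of `TaoCascadeZeroScaleCoarseBound.lean`, Prop. 6.17: `τ₁ = t_c + K^{-1/2}`,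
`Ẽ₋₁ ≤ 100K⁻¹⁴` on `[t_c, τ₁]`), with the fence `a₁ ≥ 1/20` on `[t_c + 1/K, τ₁]` of
`TaoCascadeZeroScaleFence.lean` ((6.188)), this file instantiates the generic drain estimate
`RescaledHypotheses.drain_bound` (`TaoCascadeDrainEnergy.lean`) on `[t_c + 1/K, τ₁]` with the levels
`E₋ = 100K⁻¹⁴`, `B_b = C₄K^{-1/4}ε`, `B_c = C₄e^{-K^{10}/2}ε²`, `B_d = ½K⁻¹⁰`, `c_min = K^{100}ε²`,
`b_max = 4ε`, `α₁ = 1/20`, and verifies numerically that the resulting bound is `≤ ½K⁻²⁰`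
(`Setting.sq_ad_τone_le`: **`a₀(τ₁)² + d₀(τ₁)² ≤ ½K⁻²⁰`**, i.e. (6.174) in the form consumed by
`Setting.nextState_of_drain`, `TaoCascadeZeroScaleNextState.lean`). The decay factor is
`exp(-(1+ε₀)^{5/2}K/40 · (K^{-1/2} - K⁻¹)) ≤ K⁻¹¹` (`pow_eleven_le_exp_sqrt`: `K¹¹ ≤ e^{0.0249 √K}` for
`K ≥ 10¹⁸`). Consequence: `Setting.nextState_τone` and **Prop. 6.15 in the `Setting`**,
`Setting.exists_nextState : ∃ τ₁ ∈ [1/100, T], NextState …` (for `K ≥ 10¹⁸`). Theorems only.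

## References

* T. Tao, J. Amer. Math. Soc. 29 (2016), 601–674, arXiv:1402.0290v3, §6.6 Prop. 6.15, §6.7 (6.174),
  (6.184)–(6.188) and the last paragraph. [`Tao2016AveragedNS`]
-/

noncomputable section

open Set MeasureTheory intervalIntegral Filter Topology

namespace Literature.Analysis.FluidPDE

namespace TaoCascade

namespace ZeroScale

/-! ## Numerics -/

/-- **`K¹¹ ≤ exp(999/40000 · K · K^{-1/2})` for `K ≥ 10¹⁸`** (`u = √K ≥ 10⁹`:
`e^{cu} ≥ (cu/44)^{44} ≥ u^{22}`). [folklore] -/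
theorem pow_eleven_le_exp_sqrt {K : ℝ} (hK18 : (10 : ℝ) ^ 18 ≤ K) :
    K ^ 11 ≤ Real.exp (999 / 40000 * (K * K ^ (-(1 : ℝ) / 2))) := by
  have hK : 0 < K := lt_of_lt_of_le (by norm_num) hK18
  set u : ℝ := K * K ^ (-(1 : ℝ) / 2) with hu
  have hr : 0 < K ^ (-(1 : ℝ) / 2) := Real.rpow_pos_of_pos hK _
  have hu0 : 0 < u := mul_pos hK hr
  have hsq : (K ^ (-(1 : ℝ) / 2)) ^ 2 = K⁻¹ := by
    rw [← Real.rpow_natCast, ← Real.rpow_mul hK.le]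
    norm_num
    exact Real.rpow_neg_one K
  have hu2 : u ^ 2 = K := by
    rw [hu, mul_pow, hsq]; field_simp
  -- `u ≥ 10⁹`
  have hu9 : (10 : ℝ) ^ 9 ≤ u := by
    by_contra hcon
    push Not at hcon
    have : u ^ 2 < (10 ^ 9) ^ 2 := pow_lt_pow_left₀ hcon hu0.le (by norm_num)
    rw [hu2] at this
    linarith
  set x : ℝ := 999 / 40000 * u / 44 with hx
  have hx0 : 0 ≤ x := by positivity
  have h1 : (1 + x) ^ 44 ≤ Real.exp (999 / 40000 * u) := by
    have := Real.add_one_le_exp x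
    calc (1 + x) ^ 44 ≤ (Real.exp x) ^ 44 := pow_le_pow_left₀ (by positivity) (by linarith) 44
      _ = Real.exp (44 * x) := by rw [← Real.exp_nat_mul]; norm_num
      _ = Real.exp (999 / 40000 * u) := by congr 1; simp only [hx]; ring
  have h2 : x ^ 44 ≤ (1 + x) ^ 44 := pow_le_pow_left₀ hx0 (by linarith) 44
  -- `x² ≥ u`
  have hx2 : u ≤ x ^ 2 := by
    have e : x ^ 2 = (999 / 40000 / 44) ^ 2 * u * u := by simp only [hx]; ring
    rw [e]
    have : (1 : ℝ) ≤ (999 / 40000 / 44) ^ 2 * u := by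
      have := mul_le_mul_of_nonneg_left hu9 (by norm_num : (0 : ℝ) ≤ (999 / 40000 / 44) ^ 2)
      linarith [this]
    nlinarith [this, hu0.le]
  have h3 : u ^ 22 ≤ x ^ 44 := by
    rw [show x ^ 44 = (x ^ 2) ^ 22 by ring]
    exact pow_le_pow_left₀ hu0.le hx2 22
  have h4 : K ^ 11 = u ^ 22 := by rw [← hu2]; ring
  rw [h4]
  linarith

/-- `(K^n)⁻¹ ≤ (K^{10})⁻¹ / 10^{18}` for `n ≥ 11`, `K ≥ 10¹⁸`. [folklore] -/
theorem inv_pow_le_inv_pow_ten_div {K : ℝ} (hK18 : (10 : ℝ) ^ 18 ≤ K) {n : ℕ} (hn : 11 ≤ n) :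
    (K ^ n)⁻¹ ≤ (K ^ 10)⁻¹ / 10 ^ 18 := by
  have hK : 0 < K := lt_of_lt_of_le (by norm_num) hK18
  have hK1 : 1 ≤ K := le_trans (by norm_num) hK18
  have h1 : (K ^ n)⁻¹ ≤ (K ^ 11)⁻¹ := inv_anti₀ (by positivity) (pow_le_pow_right₀ hK1 hn)
  have h2 : (K ^ 11)⁻¹ ≤ (K ^ 10)⁻¹ / 10 ^ 18 := by
    rw [div_eq_mul_inv, ← mul_inv, show K ^ 11 = K ^ 10 * K by ring]
    apply inv_anti₀ (by positivity)
    exact mul_le_mul_of_nonneg_left hK18 (by positivity)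
  exact h1.trans h2

/-- **The numeric heart of the drain**: with `β ≥ K/40`, `e^{-βd} ≤ K⁻¹¹`, `0 ≤ α ≤ 201K⁻¹³`,
`θ ≤ 100K⁻⁸⁹`, `ν₀ ≤ 12K⁻⁹⁹`, `E ≤ 1` (all for `K ≥ 10¹⁸`):
`2(e^{-βd}√(E + 2ν₀) + α/β + 3√(θ/β))² ≤ ½K⁻²⁰`. [folklore] -/
theorem drain_numeric {K β α θ ν₀ E d : ℝ} (hK18 : (10 : ℝ) ^ 18 ≤ K) (hβ : K / 40 ≤ β)
    (hed : Real.exp (-β * d) ≤ (K ^ 11)⁻¹) (hα0 : 0 ≤ α) (hα : α ≤ 201 * (K ^ 13)⁻¹)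
    (hθ : θ ≤ 100 * (K ^ 89)⁻¹) (hν : ν₀ ≤ 12 * (K ^ 99)⁻¹) (hE : E ≤ 1) :
    2 * (Real.exp (-β * d) * Real.sqrt (E + 2 * ν₀) + α / β + 3 * Real.sqrt (θ / β)) ^ 2 ≤
      (K ^ 20)⁻¹ / 2 := by
  have hK : 0 < K := lt_of_lt_of_le (by norm_num) hK18
  have hK1 : 1 ≤ K := le_trans (by norm_num) hK18
  have hβ0 : 0 < β := lt_of_lt_of_le (by positivity) hβ
  have h10 : 0 < (K ^ 10)⁻¹ := by positivity
  -- `√(E + 2ν₀) ≤ 3/2`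
  have hν1 : ν₀ ≤ 1 / 2 := by
    have : (K ^ 99)⁻¹ ≤ 1 / 24 := by
      have h99 : (24 : ℝ) ≤ K ^ 99 := by
        calc (24 : ℝ) ≤ 10 ^ 18 := by norm_num
          _ ≤ K := hK18
          _ ≤ K ^ 99 := le_self_pow₀ hK1 (by norm_num)
      rw [show (1 : ℝ) / 24 = 24⁻¹ by norm_num]
      exact inv_anti₀ (by norm_num) h99
    linarith
  have hsq : Real.sqrt (E + 2 * ν₀) ≤ 3 / 2 := by
    have h1 : E + 2 * ν₀ ≤ (3 / 2) ^ 2 := by linarith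
    calc Real.sqrt (E + 2 * ν₀) ≤ Real.sqrt ((3 / 2) ^ 2) := Real.sqrt_le_sqrt h1
      _ = 3 / 2 := Real.sqrt_sq (by norm_num)
  -- the three terms
  have hT1 : Real.exp (-β * d) * Real.sqrt (E + 2 * ν₀) ≤ (K ^ 11)⁻¹ * (3 / 2) :=
    mul_le_mul hed hsq (Real.sqrt_nonneg _) (by positivity)
  have hT2 : α / β ≤ 8040 * (K ^ 14)⁻¹ := by
    calc α / β ≤ (201 * (K ^ 13)⁻¹) / (K / 40) := div_le_div₀ (by positivity) hα (by positivity) hβ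
      _ = 8040 * (K ^ 14)⁻¹ := by field_simp; ring
  have hT3 : Real.sqrt (θ / β) ≤ 64 * (K ^ 45)⁻¹ := by
    have h1 : θ / β ≤ (100 * (K ^ 89)⁻¹) / (K / 40) := div_le_div₀ (by positivity) hθ (by positivity) hβ
    have h2 : (100 * (K ^ 89)⁻¹) / (K / 40) = 4000 * (K ^ 90)⁻¹ := by field_simp; ring
    have h3 : 4000 * (K ^ 90)⁻¹ ≤ (64 * (K ^ 45)⁻¹) ^ 2 := by
      have e : ((K ^ 45)⁻¹) ^ 2 = (K ^ 90)⁻¹ := by rw [inv_pow, ← pow_mul]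
      rw [mul_pow, e]
      have h0 : 0 ≤ (K ^ 90)⁻¹ := by positivity
      nlinarith [h0]
    calc Real.sqrt (θ / β) ≤ Real.sqrt ((64 * (K ^ 45)⁻¹) ^ 2) := Real.sqrt_le_sqrt (by linarith)
      _ = 64 * (K ^ 45)⁻¹ := Real.sqrt_sq (by positivity)
  -- each term is `≤ K⁻¹⁰/10`
  have h11 := inv_pow_le_inv_pow_ten_div hK18 (n := 11) le_rfl
  have h14 := inv_pow_le_inv_pow_ten_div hK18 (n := 14) (by norm_num)
  have h45 := inv_pow_le_inv_pow_ten_div hK18 (n := 45) (by norm_num)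
  have hinside : Real.exp (-β * d) * Real.sqrt (E + 2 * ν₀) + α / β + 3 * Real.sqrt (θ / β) ≤
      (K ^ 10)⁻¹ / 2 := by linarith
  have hinside0 : 0 ≤ Real.exp (-β * d) * Real.sqrt (E + 2 * ν₀) + α / β + 3 * Real.sqrt (θ / β) := by
    positivity
  have hsq2 := pow_le_pow_left₀ hinside0 hinside 2
  calc 2 * (Real.exp (-β * d) * Real.sqrt (E + 2 * ν₀) + α / β + 3 * Real.sqrt (θ / β)) ^ 2
      ≤ 2 * ((K ^ 10)⁻¹ / 2) ^ 2 := by linarith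
    _ = (K ^ 20)⁻¹ / 2 := by
        have e : ((K ^ 10)⁻¹) ^ 2 = (K ^ 20)⁻¹ := by rw [inv_pow, ← pow_mul]
        rw [div_pow, e]; ring

section DrainFinal

variable {ε₀ K ε C₁ C₂ C₃ C₄ C₅ : ℝ} {n₀ N : ℤ} {τ : ℤ → ℝ} {Y : Fin 4 → ℤ → ℝ → ℝ}
  {F : ℤ → ℝ → ℝ} {T : ℝ}

/-! ## The levels of `drain_bound` in the regime -/

/-- `√2 ≤ 3/2`, `(√2)² = 2`, `(√2)³ ≤ 3`. [folklore] -/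
theorem sqrt_two_facts : Real.sqrt 2 ≤ 3 / 2 ∧ Real.sqrt 2 ^ 2 = 2 ∧ Real.sqrt 2 ^ 3 ≤ 3 ∧
    1 ≤ Real.sqrt 2 := by
  have h1 : Real.sqrt 2 ≤ 3 / 2 := by
    calc Real.sqrt 2 ≤ Real.sqrt ((3 / 2) ^ 2) := Real.sqrt_le_sqrt (by norm_num)
      _ = 3 / 2 := Real.sqrt_sq (by norm_num)
  have h2 : Real.sqrt 2 ^ 2 = 2 := Real.sq_sqrt (by norm_num)
  have h4 : 1 ≤ Real.sqrt 2 := by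
    rw [show (1 : ℝ) = Real.sqrt 1 by simp]; exact Real.sqrt_le_sqrt (by norm_num)
  refine ⟨h1, h2, ?_, h4⟩
  calc Real.sqrt 2 ^ 3 = Real.sqrt 2 ^ 2 * Real.sqrt 2 := by ring
    _ ≤ 2 * (3 / 2) := by rw [h2]; exact mul_le_mul_of_nonneg_left h1 (by norm_num)
    _ = 3 := by norm_num

/-- `w₁ = 1/(ρ c_min) = K⁻¹⁰⁰` for `ρ = ε⁻²`, `c_min = K^{100}ε²`. [folklore] -/
theorem Setting.drain_w (hs : Setting ε₀ K ε C₁ C₂ C₃ C₄ C₅ n₀ N τ Y F T) :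
    1 / ((ε ^ 2)⁻¹ * (K ^ 100 * ε ^ 2)) = (K ^ 100)⁻¹ := by
  have hε := hs.ε_pos
  have hK := hs.K_pos
  field_simp

/-- `β = (1+ε₀)^{5/2}K/40 ≥ K/40`. [folklore] -/
theorem Setting.drain_beta_ge (hs : Setting ε₀ K ε C₁ C₂ C₃ C₄ C₅ n₀ N τ Y F T) :
    K / 40 ≤ (1 + ε₀) ^ ((5 : ℝ) / 2) * K * (1 / 20) / 2 := by
  have hq := hs.one_le_q52
  have hK := hs.K_pos
  have := mul_le_mul_of_nonneg_right hq hK.le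
  linarith

/-- `κ = (1+ε₀)^{5/2}K ≤ 8K`, `0 < κ`. [folklore] -/
theorem Setting.drain_kappa (hs : Setting ε₀ K ε C₁ C₂ C₃ C₄ C₅ n₀ N τ Y F T) :
    (1 + ε₀) ^ ((5 : ℝ) / 2) * K ≤ 8 * K ∧ 0 < (1 + ε₀) ^ ((5 : ℝ) / 2) * K := by
  have hq := hs.q52_le
  have hq1 := hs.one_le_q52
  have hK := hs.K_pos
  exact ⟨mul_le_mul_of_nonneg_right hq hK.le, by positivity⟩

/-- `ν₀ = ½κ(√2)³w₁ ≤ 12K⁻⁹⁹`. [folklore] -/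
theorem Setting.drain_nu0_le (hs : Setting ε₀ K ε C₁ C₂ C₃ C₄ C₅ n₀ N τ Y F T) :
    1 / 2 * ((1 + ε₀) ^ ((5 : ℝ) / 2) * K) * Real.sqrt 2 ^ 3 * (1 / ((ε ^ 2)⁻¹ * (K ^ 100 * ε ^ 2))) ≤
      12 * (K ^ 99)⁻¹ := by
  rw [hs.drain_w]
  have hκ := hs.drain_kappa
  have hK := hs.K_pos
  have h3 := sqrt_two_facts
  have h1 : 1 / 2 * ((1 + ε₀) ^ ((5 : ℝ) / 2) * K) * Real.sqrt 2 ^ 3 ≤ 1 / 2 * (8 * K) * 3 :=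
    mul_le_mul (mul_le_mul_of_nonneg_left hκ.1 (by norm_num)) h3.2.2.1 (by positivity) (by positivity)
  calc 1 / 2 * ((1 + ε₀) ^ ((5 : ℝ) / 2) * K) * Real.sqrt 2 ^ 3 * (K ^ 100)⁻¹
      ≤ 1 / 2 * (8 * K) * 3 * (K ^ 100)⁻¹ := mul_le_mul_of_nonneg_right h1 (by positivity)
    _ = 12 * (K ^ 99)⁻¹ := by field_simp; ring

/-- `η = C₁(1+ε₀)^{-n₀/2} ≤ ε⁴`. [folklore] -/
theorem Setting.drain_eta_le (hs : Setting ε₀ K ε C₁ C₂ C₃ C₄ C₅ n₀ N τ Y F T) :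
    C₁ * (1 + ε₀) ^ (-((n₀ : ℝ) / 2)) ≤ ε ^ 4 ∧ 0 ≤ C₁ * (1 + ε₀) ^ (-((n₀ : ℝ) / 2)) := by
  rw [rpow_neg_half_eq]
  have hq := hs.q_pos
  have hC₁ := hs.C₁_nn
  exact ⟨hs.ρ_le_ε4.1, by positivity⟩

/-- `η₁ + η ≤ 201K⁻¹³` (`E₋ = 100K⁻¹⁴`). [folklore] -/
theorem Setting.drain_eta1_le (hs : Setting ε₀ K ε C₁ C₂ C₃ C₄ C₅ n₀ N τ Y F T) :
    2 * ε + 2 * ε ^ 2 * Real.exp (-K ^ 10) + 2 * K * (100 * (K ^ 14)⁻¹) +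
        C₁ * (1 + ε₀) ^ (-((n₀ : ℝ) / 2)) + C₁ * (1 + ε₀) ^ (-((n₀ : ℝ) / 2)) ≤ 201 * (K ^ 13)⁻¹ ∧
      0 ≤ 2 * ε + 2 * ε ^ 2 * Real.exp (-K ^ 10) + 2 * K * (100 * (K ^ 14)⁻¹) +
        C₁ * (1 + ε₀) ^ (-((n₀ : ℝ) / 2)) + C₁ * (1 + ε₀) ^ (-((n₀ : ℝ) / 2)) := by
  have hη := hs.drain_eta_le
  have hε := hs.ε_pos
  have hK := hs.K_pos
  have hK1 := hs.one_le_K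
  have hεs := hs.ε_small
  have hεK := hs.ε_le_K100
  refine ⟨?_, by have := hη.2; positivity⟩
  have hE : Real.exp (-K ^ 10) ≤ 1 := Real.exp_le_one_iff.2 (by nlinarith [pow_pos hK 10])
  have h1 : 2 * ε ^ 2 * Real.exp (-K ^ 10) ≤ 2 * ε ^ 2 * 1 := mul_le_mul_of_nonneg_left hE (by positivity)
  have h2 : 2 * K * (100 * (K ^ 14)⁻¹) = 200 * (K ^ 13)⁻¹ := by field_simp; ring
  have hε2 : ε ^ 2 ≤ ε := by nlinarith [hεs.2]
  have hε4 : ε ^ 4 ≤ ε := by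
    calc ε ^ 4 ≤ ε ^ 1 := pow_le_pow_of_le_one hε.le hεs.2 (by norm_num)
      _ = ε := pow_one ε
  have h3 : 6 * ε ≤ (K ^ 13)⁻¹ := by
    have h100 : (K ^ 100)⁻¹ ≤ (K ^ 13)⁻¹ / 6 := by
      rw [div_eq_mul_inv, ← mul_inv, show K ^ 100 = K ^ 13 * K ^ 87 by ring, mul_inv, mul_inv]
      apply mul_le_mul_of_nonneg_left _ (by positivity)
      apply inv_anti₀ (by norm_num)
      calc (6 : ℝ) ≤ 10 ^ 6 := by norm_num
        _ ≤ K := hs.K_large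
        _ ≤ K ^ 87 := le_self_pow₀ hK1 (by norm_num)
    linarith
  rw [h2]
  linarith [hη.1]

/-- `ν ≤ K⁻²⁰` (`B_b = C₄K^{-1/4}ε`, `B_c = C₄e^{-K^{10}/2}ε²`; `16C₄ε² ≤ K⁻²⁰`). [folklore] -/
theorem Setting.drain_nu_le (hs : Setting ε₀ K ε C₁ C₂ C₃ C₄ C₅ n₀ N τ Y F T) :
    (1 + ε₀) ^ ((5 : ℝ) / 2) * (ε * (C₄ * K ^ (-(1 : ℝ) / 4) * ε) +
        ε ^ 2 * Real.exp (-K ^ 10) * (C₄ * Real.exp (-K ^ 10 / 2) * ε ^ 2)) ≤ (K ^ 20)⁻¹ ∧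
      0 ≤ (1 + ε₀) ^ ((5 : ℝ) / 2) * (ε * (C₄ * K ^ (-(1 : ℝ) / 4) * ε) +
        ε ^ 2 * Real.exp (-K ^ 10) * (C₄ * Real.exp (-K ^ 10 / 2) * ε ^ 2)) := by
  have hq := hs.q52_le
  have hq0 := hs.q_pos
  have hC₄ := hs.C₄_nn
  have hK := hs.K_pos
  have hε := hs.ε_pos
  have hεs := hs.ε_small
  have hν := hs.nu_le
  refine ⟨?_, by positivity⟩
  have hK4 : K ^ (-(1 : ℝ) / 4) ≤ 1 := hs.K_rpow_neg_quarter_le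
  have hE1 : Real.exp (-K ^ 10) ≤ 1 := Real.exp_le_one_iff.2 (by nlinarith [pow_pos hK 10])
  have hE2 : Real.exp (-K ^ 10 / 2) ≤ 1 := Real.exp_le_one_iff.2 (by nlinarith [pow_pos hK 10])
  have h1 : ε * (C₄ * K ^ (-(1 : ℝ) / 4) * ε) ≤ C₄ * ε ^ 2 := by
    have := mul_le_mul_of_nonneg_left hK4 hC₄
    nlinarith [this, sq_nonneg ε, hε.le]
  have h2 : ε ^ 2 * Real.exp (-K ^ 10) * (C₄ * Real.exp (-K ^ 10 / 2) * ε ^ 2) ≤ C₄ * ε ^ 2 := by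
    have hε2 : ε ^ 2 ≤ 1 := by nlinarith [hεs.2, hε.le]
    calc ε ^ 2 * Real.exp (-K ^ 10) * (C₄ * Real.exp (-K ^ 10 / 2) * ε ^ 2)
        ≤ 1 * 1 * (C₄ * 1 * ε ^ 2) := by gcongr
      _ = C₄ * ε ^ 2 := by ring
  calc (1 + ε₀) ^ ((5 : ℝ) / 2) * (ε * (C₄ * K ^ (-(1 : ℝ) / 4) * ε) +
        ε ^ 2 * Real.exp (-K ^ 10) * (C₄ * Real.exp (-K ^ 10 / 2) * ε ^ 2))
      ≤ 8 * (C₄ * ε ^ 2 + C₄ * ε ^ 2) := mul_le_mul hq (by linarith) (by positivity) (by norm_num)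
    _ = 16 * C₄ * ε ^ 2 := by ring
    _ ≤ (K ^ 20)⁻¹ := hν

/-- `η₃ ≤ K⁻²⁰` (`B_c = C₄e^{-K^{10}/2}ε²`, `B_d = ½K⁻¹⁰`; `eta3_le`). [folklore] -/
theorem Setting.drain_eta3_le (hs : Setting ε₀ K ε C₁ C₂ C₃ C₄ C₅ n₀ N τ Y F T) :
    (1 + ε₀) ^ ((5 : ℝ) / 2) * (ε ^ 2)⁻¹ * (C₄ * Real.exp (-K ^ 10 / 2) * ε ^ 2) * (1 / 2 * (K ^ 10)⁻¹) +
        C₁ * (1 + ε₀) ^ (2 - (n₀ : ℝ) / 2) ≤ (K ^ 20)⁻¹ ∧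
      0 ≤ (1 + ε₀) ^ ((5 : ℝ) / 2) * (ε ^ 2)⁻¹ * (C₄ * Real.exp (-K ^ 10 / 2) * ε ^ 2) *
        (1 / 2 * (K ^ 10)⁻¹) + C₁ * (1 + ε₀) ^ (2 - (n₀ : ℝ) / 2) := by
  have hq := hs.q52_le
  have hq0 := hs.q_pos
  have hq2 := hs.q_lt_two
  have hC₄ := hs.C₄_nn
  have hC₁ := hs.C₁_nn
  have hK := hs.K_pos
  have hε := hs.ε_pos
  have h3 := hs.eta3_le
  refine ⟨?_, by positivity⟩
  have e1 : (1 + ε₀) ^ ((5 : ℝ) / 2) * (ε ^ 2)⁻¹ * (C₄ * Real.exp (-K ^ 10 / 2) * ε ^ 2) *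
      (1 / 2 * (K ^ 10)⁻¹) =
      (1 + ε₀) ^ ((5 : ℝ) / 2) * (1 / 2) * (C₄ * Real.exp (-K ^ 10 / 2) * (K ^ 10)⁻¹) := by
    field_simp
  have e2 : (1 + ε₀) ^ (2 - (n₀ : ℝ) / 2) = (1 + ε₀) ^ (2 : ℝ) * (1 + ε₀) ^ (-(n₀ : ℝ) / 2) := by
    rw [← Real.rpow_add hq0]; congr 1; ring
  have hq22 : (1 + ε₀) ^ (2 : ℝ) ≤ 4 := by
    rw [show (2 : ℝ) = ((2 : ℕ) : ℝ) by norm_num, Real.rpow_natCast]; nlinarith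
  rw [e1, e2]
  have h1 : (1 + ε₀) ^ ((5 : ℝ) / 2) * (1 / 2) * (C₄ * Real.exp (-K ^ 10 / 2) * (K ^ 10)⁻¹) ≤
      8 * (1 / 2) * (C₄ * Real.exp (-K ^ 10 / 2) * (K ^ 10)⁻¹) :=
    mul_le_mul_of_nonneg_right (mul_le_mul_of_nonneg_right hq (by norm_num)) (by positivity)
  have h2 : C₁ * ((1 + ε₀) ^ (2 : ℝ) * (1 + ε₀) ^ (-(n₀ : ℝ) / 2)) ≤ C₁ * (4 * (1 + ε₀) ^ (-(n₀ : ℝ) / 2)) :=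
    mul_le_mul_of_nonneg_left (mul_le_mul_of_nonneg_right hq22 (by positivity)) hC₁
  linarith

/-- `L ≤ 5K^{10}` (`b_max = 4ε`, `c_min = K^{100}ε²`). [folklore] -/
theorem Setting.drain_L_le (hs : Setting ε₀ K ε C₁ C₂ C₃ C₄ C₅ n₀ N τ Y F T) :
    ε⁻¹ * K ^ 10 * (4 * ε) +
        (ε ^ 2 * Real.exp (-K ^ 10) * Real.sqrt 2 ^ 2 + C₁ * (1 + ε₀) ^ (-((n₀ : ℝ) / 2))) /
          (K ^ 100 * ε ^ 2) ≤ 5 * K ^ 10 ∧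
      0 ≤ ε⁻¹ * K ^ 10 * (4 * ε) +
        (ε ^ 2 * Real.exp (-K ^ 10) * Real.sqrt 2 ^ 2 + C₁ * (1 + ε₀) ^ (-((n₀ : ℝ) / 2))) /
          (K ^ 100 * ε ^ 2) := by
  have hη := hs.drain_eta_le
  have hε := hs.ε_pos
  have hK := hs.K_pos
  have hK1 := hs.one_le_K
  have hεs := hs.ε_small
  refine ⟨?_, by have := hη.2; positivity⟩
  have h2 := sqrt_two_facts
  rw [h2.2.1]
  have e1 : ε⁻¹ * K ^ 10 * (4 * ε) = 4 * K ^ 10 := by field_simp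
  rw [e1]
  have hE1 : Real.exp (-K ^ 10) ≤ 1 := Real.exp_le_one_iff.2 (by nlinarith [pow_pos hK 10])
  have hnum : ε ^ 2 * Real.exp (-K ^ 10) * 2 + C₁ * (1 + ε₀) ^ (-((n₀ : ℝ) / 2)) ≤ 3 * ε ^ 2 := by
    have h1 : ε ^ 2 * Real.exp (-K ^ 10) * 2 ≤ ε ^ 2 * 1 * 2 := by gcongr
    have h3 : ε ^ 4 ≤ ε ^ 2 := pow_le_pow_of_le_one hε.le hεs.2 (by norm_num)
    linarith [hη.1]
  have hfrac : (ε ^ 2 * Real.exp (-K ^ 10) * 2 + C₁ * (1 + ε₀) ^ (-((n₀ : ℝ) / 2))) / (K ^ 100 * ε ^ 2) ≤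
      3 * (K ^ 100)⁻¹ := by
    rw [div_le_iff₀ (by positivity)]
    calc ε ^ 2 * Real.exp (-K ^ 10) * 2 + C₁ * (1 + ε₀) ^ (-((n₀ : ℝ) / 2)) ≤ 3 * ε ^ 2 := hnum
      _ = 3 * (K ^ 100)⁻¹ * (K ^ 100 * ε ^ 2) := by field_simp
  have h100 : (K ^ 100)⁻¹ ≤ 1 := by
    apply inv_le_one_of_one_le₀; exact one_le_pow₀ hK1
  have hK10 : (3 : ℝ) ≤ K ^ 10 := by
    calc (3 : ℝ) ≤ 10 ^ 6 := by norm_num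
      _ ≤ K := hs.K_large
      _ ≤ K ^ 10 := le_self_pow₀ hK1 (by norm_num)
  linarith

/-- `Θ ≤ 70K⁻⁸⁹`. [folklore] -/
theorem Setting.drain_Theta_le (hs : Setting ε₀ K ε C₁ C₂ C₃ C₄ C₅ n₀ N τ Y F T) :
    1 / 2 * ((1 + ε₀) ^ ((5 : ℝ) / 2) * K) * (1 / ((ε ^ 2)⁻¹ * (K ^ 100 * ε ^ 2))) *
        ((2 * ε + 2 * ε ^ 2 * Real.exp (-K ^ 10) + 2 * K * (100 * (K ^ 14)⁻¹) +
              C₁ * (1 + ε₀) ^ (-((n₀ : ℝ) / 2)) + C₁ * (1 + ε₀) ^ (-((n₀ : ℝ) / 2))) * Real.sqrt 2 ^ 2 +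
          Real.sqrt 2 ^ 2 * ((1 + ε₀) ^ ((5 : ℝ) / 2) * K * Real.sqrt 2 ^ 2 +
            (1 + ε₀) ^ ((5 : ℝ) / 2) * (ε * (C₄ * K ^ (-(1 : ℝ) / 4) * ε) +
              ε ^ 2 * Real.exp (-K ^ 10) * (C₄ * Real.exp (-K ^ 10 / 2) * ε ^ 2)) * Real.sqrt 2 +
            ((1 + ε₀) ^ ((5 : ℝ) / 2) * (ε ^ 2)⁻¹ * (C₄ * Real.exp (-K ^ 10 / 2) * ε ^ 2) *
              (1 / 2 * (K ^ 10)⁻¹) + C₁ * (1 + ε₀) ^ (2 - (n₀ : ℝ) / 2))) +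
          Real.sqrt 2 ^ 3 * (ε⁻¹ * K ^ 10 * (4 * ε) +
            (ε ^ 2 * Real.exp (-K ^ 10) * Real.sqrt 2 ^ 2 + C₁ * (1 + ε₀) ^ (-((n₀ : ℝ) / 2))) /
              (K ^ 100 * ε ^ 2))) ≤ 70 * (K ^ 89)⁻¹ := by
  have hη1 := hs.drain_eta1_le
  have hν := hs.drain_nu_le
  have hη3 := hs.drain_eta3_le
  have hL := hs.drain_L_le
  have hκ := hs.drain_kappa
  have hK := hs.K_pos
  have hK1 := hs.one_le_K
  have h2 := sqrt_two_facts
  rw [hs.drain_w]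
  -- abbreviate the levels
  set A := 2 * ε + 2 * ε ^ 2 * Real.exp (-K ^ 10) + 2 * K * (100 * (K ^ 14)⁻¹) +
    C₁ * (1 + ε₀) ^ (-((n₀ : ℝ) / 2)) + C₁ * (1 + ε₀) ^ (-((n₀ : ℝ) / 2)) with hA
  set V := (1 + ε₀) ^ ((5 : ℝ) / 2) * (ε * (C₄ * K ^ (-(1 : ℝ) / 4) * ε) +
    ε ^ 2 * Real.exp (-K ^ 10) * (C₄ * Real.exp (-K ^ 10 / 2) * ε ^ 2)) with hV
  set H := (1 + ε₀) ^ ((5 : ℝ) / 2) * (ε ^ 2)⁻¹ * (C₄ * Real.exp (-K ^ 10 / 2) * ε ^ 2) *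
    (1 / 2 * (K ^ 10)⁻¹) + C₁ * (1 + ε₀) ^ (2 - (n₀ : ℝ) / 2) with hH
  set L := ε⁻¹ * K ^ 10 * (4 * ε) +
    (ε ^ 2 * Real.exp (-K ^ 10) * Real.sqrt 2 ^ 2 + C₁ * (1 + ε₀) ^ (-((n₀ : ℝ) / 2))) /
      (K ^ 100 * ε ^ 2) with hL'
  set κ := (1 + ε₀) ^ ((5 : ℝ) / 2) * K with hκ'
  rw [h2.2.1]
  -- the bracket is `≤ 17 K^{10}`
  have h20 : (K ^ 20)⁻¹ ≤ 1 := inv_le_one_of_one_le₀ (one_le_pow₀ hK1)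
  have h13 : (K ^ 13)⁻¹ ≤ 1 := inv_le_one_of_one_le₀ (one_le_pow₀ hK1)
  have hK10 : K ≤ K ^ 10 := le_self_pow₀ hK1 (by norm_num)
  have hK9 : (17 : ℝ) ≤ K ^ 9 := by
    calc (17 : ℝ) ≤ 10 ^ 6 := by norm_num
      _ ≤ K := hs.K_large
      _ ≤ K ^ 9 := le_self_pow₀ hK1 (by norm_num)
  have hbr : A * 2 + 2 * (κ * 2 + V * Real.sqrt 2 + H) + Real.sqrt 2 ^ 3 * L ≤ 17 * K ^ 10 := by
    have h1 : A * 2 ≤ 201 * 2 := by linarith [hη1.1, h13]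
    have h3 : V * Real.sqrt 2 ≤ 1 * (3 / 2) := mul_le_mul (hν.1.trans h20) h2.1 (by positivity) (by norm_num)
    have h4 : H ≤ 1 := hη3.1.trans h20
    have h5 : Real.sqrt 2 ^ 3 * L ≤ 3 * (5 * K ^ 10) := mul_le_mul h2.2.2.1 hL.1 hL.2 (by norm_num)
    have h6 : κ * 2 ≤ 8 * K * 2 := by linarith [hκ.1]
    have h7 : (440 : ℝ) + 32 * K ≤ 2 * K ^ 10 := by
      have : K * 17 ≤ K * K ^ 9 := mul_le_mul_of_nonneg_left hK9 hK.le
      have e : K * K ^ 9 = K ^ 10 := by ring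
      rw [e] at this
      linarith [this, hs.K_large]
    linarith [h1, h3, h4, h5, h6, h7]
  have hbr0 : 0 ≤ A * 2 + 2 * (κ * 2 + V * Real.sqrt 2 + H) + Real.sqrt 2 ^ 3 * L := by
    have := hη1.2; have := hν.2; have := hη3.2; have := hL.2; have := hκ.2; positivity
  calc 1 / 2 * κ * (K ^ 100)⁻¹ * (A * 2 + 2 * (κ * 2 + V * Real.sqrt 2 + H) + Real.sqrt 2 ^ 3 * L)
      ≤ 1 / 2 * (8 * K) * (K ^ 100)⁻¹ * (17 * K ^ 10) := by
        apply mul_le_mul _ hbr hbr0 (by positivity)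
        exact mul_le_mul_of_nonneg_right (mul_le_mul_of_nonneg_left hκ.1 (by norm_num)) (by positivity)
    _ = 68 * (K ^ 89)⁻¹ := by field_simp; ring
    _ ≤ 70 * (K ^ 89)⁻¹ := by
        have : 0 ≤ (K ^ 89)⁻¹ := by positivity
        linarith

/-- `θ = (κ√2ν₀ + Θ)/2 ≤ 100K⁻⁸⁹`. [folklore] -/
theorem Setting.drain_theta_le (hs : Setting ε₀ K ε C₁ C₂ C₃ C₄ C₅ n₀ N τ Y F T) {Θ ν₀ : ℝ}
    (hΘ : Θ ≤ 70 * (K ^ 89)⁻¹) (hν₀ : ν₀ ≤ 12 * (K ^ 99)⁻¹) (hν₀0 : 0 ≤ ν₀) :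
    ((1 + ε₀) ^ ((5 : ℝ) / 2) * K * Real.sqrt 2 * ν₀ + Θ) / 2 ≤ 100 * (K ^ 89)⁻¹ := by
  have hκ := hs.drain_kappa
  have hK := hs.K_pos
  have hK1 := hs.one_le_K
  have h2 := sqrt_two_facts
  have h1 : (1 + ε₀) ^ ((5 : ℝ) / 2) * K * Real.sqrt 2 * ν₀ ≤ 8 * K * (3 / 2) * (12 * (K ^ 99)⁻¹) :=
    mul_le_mul (mul_le_mul hκ.1 h2.1 (by positivity) (by positivity)) hν₀ hν₀0 (by positivity)
  have e : 8 * K * (3 / 2) * (12 * (K ^ 99)⁻¹) = 144 * (K ^ 98)⁻¹ := by field_simp; ring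
  have h3 : 144 * (K ^ 98)⁻¹ ≤ (K ^ 89)⁻¹ := by
    rw [show K ^ 98 = K ^ 89 * K ^ 9 by ring, mul_inv]
    have hK9 : (144 : ℝ) ≤ K ^ 9 := by
      calc (144 : ℝ) ≤ 10 ^ 6 := by norm_num
        _ ≤ K := hs.K_large
        _ ≤ K ^ 9 := le_self_pow₀ hK1 (by norm_num)
    have : 144 * (K ^ 9)⁻¹ ≤ 1 := by
      rw [← div_eq_mul_inv, div_le_one (by positivity)]; exact hK9
    have h0 : 0 ≤ (K ^ 89)⁻¹ := by positivity
    nlinarith [this, h0]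
  have h0 : 0 ≤ (K ^ 89)⁻¹ := by positivity
  linarith

/-- **The decay factor**: `exp(-β(τ₁ - (t_c + 1/K))) ≤ K⁻¹¹` for `β = (1+ε₀)^{5/2}K/40`,
`τ₁ = t_c + K^{-1/2}`, `K ≥ 10¹⁸`. [cite: Tao2016AveragedNS, §6.7, last paragraph] -/
theorem Setting.drain_decay_le (hs : Setting ε₀ K ε C₁ C₂ C₃ C₄ C₅ n₀ N τ Y F T)
    (hex : ExitTrichotomy ε₀ K Y F T) (hK18 : (10 : ℝ) ^ 18 ≤ K) :
    Real.exp (-((1 + ε₀) ^ ((5 : ℝ) / 2) * K * (1 / 20) / 2) *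
        (τone K ε Y T - (tc K ε Y T + K⁻¹))) ≤ (K ^ 11)⁻¹ := by
  have hτ := hs.τone_eq hex hK18
  have hK := hs.K_pos
  have hr0 := hs.K_rpow_neg_half_pos
  have hr3 := hs.K_rpow_neg_half_le
  have hrsq := hs.K_rpow_neg_half_sq
  have hβ := hs.drain_beta_ge
  set r : ℝ := K ^ (-(1 : ℝ) / 2) with hr
  have hd : τone K ε Y T - (tc K ε Y T + K⁻¹) = r - r ^ 2 := by rw [hτ, hrsq]; ring
  rw [hd]
  -- `β (r - r²) ≥ (K/40)(999/1000) r = 999/40000 · K r`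
  have hrr : r - r ^ 2 ≥ 999 / 1000 * r := by nlinarith [hr0, hr3]
  have h1 : 999 / 40000 * (K * r) ≤ (1 + ε₀) ^ ((5 : ℝ) / 2) * K * (1 / 20) / 2 * (r - r ^ 2) := by
    have hβ0 : 0 ≤ (1 + ε₀) ^ ((5 : ℝ) / 2) * K * (1 / 20) / 2 := le_trans (by positivity) hβ
    have := mul_le_mul hβ hrr.le (by positivity) hβ0
    linarith [this]
  have hmain := pow_eleven_le_exp_sqrt hK18
  rw [neg_mul, Real.exp_neg]
  apply inv_anti₀ (by positivity)
  exact hmain.trans (Real.exp_le_exp.2 h1)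

/-! ## The drain at `τ₁` -/

/-- **(6.174): `a₀(τ₁)² + d₀(τ₁)² ≤ ½K⁻²⁰`** in the `Setting`, for `K ≥ 10¹⁸` — the generic drain
estimate `RescaledHypotheses.drain_bound` on `[t_c + 1/K, τ₁]` (fence `a₁ ≥ 1/20`, fast rotor
`c₀ ≥ K^{100}ε²`, `Ẽ₋₁ ≤ 100K⁻¹⁴` by Prop. 6.17) and the numerics above.
[cite: Tao2016AveragedNS, §6.7 (6.174), (6.184)–(6.188)] -/
theorem Setting.sq_ad_τone_le (hs : Setting ε₀ K ε C₁ C₂ C₃ C₄ C₅ n₀ N τ Y F T)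
    (hex : ExitTrichotomy ε₀ K Y F T) (hK18 : (10 : ℝ) ^ 18 ≤ K) :
    Y 0 0 (τone K ε Y T) ^ 2 + Y 3 0 (τone K ε Y T) ^ 2 ≤ (K ^ 20)⁻¹ / 2 := by
  have hτ := hs.τone_eq hex hK18
  have hb := hs.τone_bounds hex
  have hK := hs.K_pos
  have hε := hs.ε_pos
  have hKb := hs.inv_K_bounds
  have hr0 := hs.K_rpow_neg_half_pos
  have hr3 := hs.K_rpow_neg_half_le
  have hrsq := hs.K_rpow_neg_half_sq
  have htc0 : 0 ≤ tc K ε Y T := hs.tc_mem.1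
  -- `K⁻¹ ≤ K^{-1/2}`, so `I' = [t_c + 1/K, τ₁]` is a subinterval of the rotor phase
  have hKr : K⁻¹ ≤ K ^ (-(1 : ℝ) / 2) := by rw [← hrsq]; nlinarith [hr0, hr3]
  have hI : tc K ε Y T + K⁻¹ ≤ τone K ε Y T := by rw [hτ]; linarith
  have hs₁0 : 0 ≤ tc K ε Y T + K⁻¹ := by linarith [hKb.2.2.2]
  have hmemR : ∀ t ∈ Icc (tc K ε Y T + K⁻¹) (τone K ε Y T), t ∈ Icc (tc K ε Y T) (τone K ε Y T) :=
    fun t ht => ⟨by linarith [ht.1, hKb.2.2.2], ht.2⟩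
  have hmem0 : ∀ t ∈ Icc (tc K ε Y T + K⁻¹) (τone K ε Y T), t ∈ Icc 0 T :=
    fun t ht => (hs.mem_rotor hex (hmemR t ht)).1
  have hmemI : ∀ t ∈ Icc (tc K ε Y T + K⁻¹) (τone K ε Y T),
      t ∈ Icc (tc K ε Y T + (K ^ 9)⁻¹) (τone K ε Y T) :=
    fun t ht => ⟨by linarith [ht.1, hKb.2.1], ht.2⟩
  have hreg : ∀ t ∈ Icc (tc K ε Y T + K⁻¹) (τone K ε Y T),
      F 0 t ≤ 1 ∧ F 1 t ≤ 1 ∧ F (-1) t ≤ 100 * (K ^ 14)⁻¹ := fun t ht =>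
    ⟨hs.F_zero_le_one (hmem0 t ht), hs.F_one_le_one (hmem0 t ht),
      hs.F_negOne_le_rotor_phase hex hK18 (hmemR t ht)⟩
  have hsec : ∀ t ∈ Icc (tc K ε Y T + K⁻¹) (τone K ε Y T),
      |Y 1 1 t| ≤ C₄ * K ^ (-(1 : ℝ) / 4) * ε ∧ |Y 2 1 t| ≤ C₄ * Real.exp (-K ^ 10 / 2) * ε ^ 2 ∧
        |Y 3 1 t| ≤ 1 / 2 * (K ^ 10)⁻¹ := fun t ht =>
    ⟨hs.small.b_one t (hmem0 t ht), hs.small.c_one t (hmem0 t ht), (hs.loc t (hmem0 t ht)).d_le⟩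
  have hc : ∀ t ∈ Icc (tc K ε Y T + K⁻¹) (τone K ε Y T), K ^ 100 * ε ^ 2 ≤ Y 2 0 t := fun t ht =>
    hs.c_zero_large hex (hmemI t ht)
  have hbz : ∀ t ∈ Icc (tc K ε Y T + K⁻¹) (τone K ε Y T), |Y 1 0 t| ≤ 4 * ε := by
    intro t ht
    have h1 := hs.b_zero_rotor hex (hmemR t ht)
    rw [abs_of_nonneg (by linarith [h1.1, hε.le])]
    exact h1.2
  have ha₁ : ∀ t ∈ Icc (tc K ε Y T + K⁻¹) (τone K ε Y T), 1 / 20 ≤ Y 0 1 t := fun t ht =>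
    hs.a_one_ge_twentieth hex hI ht
  have h := hs.hyp.drain_bound hε hK hs.C₁_nn hs.ε₀_pos hs.le_N (s₁ := tc K ε Y T + K⁻¹)
    (T' := τone K ε Y T) (Em := 100 * (K ^ 14)⁻¹) (Bb := C₄ * K ^ (-(1 : ℝ) / 4) * ε)
    (Bc := C₄ * Real.exp (-K ^ 10 / 2) * ε ^ 2) (Bd := 1 / 2 * (K ^ 10)⁻¹) (cmin := K ^ 100 * ε ^ 2)
    (bmax := 4 * ε) (α₁ := 1 / 20) hs₁0 hI (by positivity) (by norm_num) hreg hsec hc hbz ha₁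
    (t := τone K ε Y T) ⟨hI, le_rfl⟩
  dsimp only at h
  -- the level bounds
  have hη1 := hs.drain_eta1_le
  have hν0 := hs.drain_nu0_le
  have hΘ := hs.drain_Theta_le
  have hw := hs.drain_w
  have h2 := sqrt_two_facts
  have hκ := hs.drain_kappa
  have hE1 : F 0 (tc K ε Y T + K⁻¹) ≤ 1 := hs.F_zero_le_one (hmem0 _ ⟨le_rfl, hI⟩)
  have hν00 : 0 ≤ 1 / 2 * ((1 + ε₀) ^ ((5 : ℝ) / 2) * K) * Real.sqrt 2 ^ 3 *
      (1 / ((ε ^ 2)⁻¹ * (K ^ 100 * ε ^ 2))) := by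
    rw [hw]; have := hκ.2; positivity
  refine h.trans (drain_numeric hK18 hs.drain_beta_ge (hs.drain_decay_le hex hK18) ?_ ?_ ?_ hν0 hE1)
  · -- `0 ≤ α`
    have := hη1.2; positivity
  · -- `α ≤ 201 K⁻¹³`
    exact (div_le_self hη1.2 h2.2.2.2).trans hη1.1
  · -- `θ ≤ 100 K⁻⁸⁹`
    exact hs.drain_theta_le hΘ hν0 hν00

/-- **`NextState` at `τ₁`** (Prop. 6.15's state bounds) in the `Setting`, for `K ≥ 10¹⁸`.
[cite: Tao2016AveragedNS, §6.6 Prop. 6.15 (6.139)–(6.144), §6.7] -/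
theorem Setting.nextState_τone (hs : Setting ε₀ K ε C₁ C₂ C₃ C₄ C₅ n₀ N τ Y F T)
    (hex : ExitTrichotomy ε₀ K Y F T) (hK18 : (10 : ℝ) ^ 18 ≤ K) :
    NextState ε₀ K ε Y F (τone K ε Y T) := by
  have hτ := hs.τone_eq hex hK18
  have hK := hs.K_pos
  have hr0 := hs.K_rpow_neg_half_pos
  have hr3 := hs.K_rpow_neg_half_le
  have hrsq := hs.K_rpow_neg_half_sq
  have hKr : K⁻¹ ≤ K ^ (-(1 : ℝ) / 2) := by rw [← hrsq]; nlinarith [hr0, hr3]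
  have hI : tc K ε Y T + K⁻¹ ≤ τone K ε Y T := by rw [hτ]; linarith
  have ha₁ : 0 < Y 0 1 (τone K ε Y T) :=
    lt_of_lt_of_le (by norm_num) (hs.a_one_ge_twentieth hex hI ⟨hI, le_rfl⟩)
  exact hs.nextState_of_drain hex hτ (hs.sq_ad_τone_le hex hK18) ha₁

/-- **Prop. 6.15 (reduced induction claim, II) in the `Setting`**, for `K ≥ 10¹⁸`: there is
`τ₁ ∈ [1/100, T₂]` with the state bounds (6.139)–(6.144).
[cite: Tao2016AveragedNS, §6.6 Prop. 6.15] -/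
theorem Setting.exists_nextState (hs : Setting ε₀ K ε C₁ C₂ C₃ C₄ C₅ n₀ N τ Y F T)
    (hK18 : (10 : ℝ) ^ 18 ≤ K) (hex : ExitTrichotomy ε₀ K Y F T) :
    ∃ τ₁ ∈ Icc (1 / 100 : ℝ) T, NextState ε₀ K ε Y F τ₁ :=
  ⟨τone K ε Y T, hs.τone_mem_Icc hex, hs.nextState_τone hex hK18⟩

end DrainFinal

end ZeroScale

end TaoCascade

end Literature.Analysis.FluidPDE
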